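import Mathlib
import Summits.MatrixMultiplication.Statement
import Summits.MatrixMultiplication.MatrixMultiplication.Theorems.GraphEquationsKernelJet

/-!
# GraphEquations — POLYNOMIAL KERNEL SECTIONS at a point of maximal rank (M18e-2, decomp-mm-lens-5 g31)

(supports `MultiplicityReduction`, stmt-MatrixMultiplication-27806, hand 1 = BOP′ at `K = 2`.)

Proof of the classical input B2 of the jet bridge: **`kernelSectionAtMaxRank`**, hence
**`kernelJetLift : KernelJetLift`**, hence rung `K = 2` of bounded-order purification from
`IsolationAtMaxRank` ALONE (`boundedOrderPurification_two_of_isolationAtMaxRank`).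

The argument (generalised Cramer rule), for a matrix `A` over `P = ℂ[y]` with `rank A(y) ≤ rank A(0) = r`
for all `y` and `A(0) γ = 0`:
* `exists_submatrix_det_ne_zero` — a matrix of rank `r` over a field has an `r × r` submatrix with
  non-zero determinant (independent columns, then independent rows); applied to `A(0)` it gives
  `D = A_{e,f}` with `Δ = det D`, `Δ(0) ≠ 0`.
* `det_submatrix_eq_zero_of_rank_lt` — every `(r+1) × (r+1)` minor of every `A(y)` vanishes, hence
  (ℂ infinite) every `(r+1) × (r+1)` minor of `A` vanishes in `P`.
* the section `η := Δ·γ − ι_f(adj D · (A_e γ))` satisfies `A_e η = 0` by `D · adj D = Δ` and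
  `η(0) = Δ(0)·γ` because `A_e(0) γ = 0`;
* every other row of `A` is, over the fraction field `F = Frac P`, a combination of the rows `e`
  (Schur complement of the bordered minors, `Matrix.det_fromBlocks₁₁`), so `A η = 0` in `F`, hence
  in `P`.

No `sorry`.  Sources: [CoxLittleOShea2015, Ch. 5 §3]; [LeykinVerscheldeZhao2006, §3].
-/

set_option linter.dupNamespace false

noncomputable section

open scoped BigOperators

namespace Summit.MatrixMultiplication.MatrixMultiplication.Theorems.GraphEquations

open MvPolynomial
open Literature.Computability.AlgebraicComplexity

/-! ## Minors and rank over a field -/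

section minors

variable {K : Type*} [Field K] {ι κ : Type*} [Fintype κ]

/-- A square submatrix of size exceeding the rank is singular. -/
theorem det_submatrix_eq_zero_of_rank_lt {k : Type*} [Fintype k] [DecidableEq k]
    (B : Matrix ι κ K) (hB : B.rank < Fintype.card k) (e : k → ι) (f : k → κ) :
    (B.submatrix e f).det = 0 := by
  by_contra h
  have hu : IsUnit (B.submatrix e f) :=
    (Matrix.isUnit_iff_isUnit_det _).mpr (isUnit_iff_ne_zero.mpr h)
  have h1 := Matrix.rank_of_isUnit _ hu
  have h2 := Matrix.rank_submatrix_le B e f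
  omega

/-- **A matrix of rank `r` over a field has an `r × r` submatrix with non-zero determinant.** -/
theorem exists_submatrix_det_ne_zero [Fintype ι] (B : Matrix ι κ K) :
    ∃ (e : Fin B.rank → ι) (f : Fin B.rank → κ), (B.submatrix e f).det ≠ 0 := by
  classical
  -- independent columns spanning the column space
  obtain ⟨κ₁, a, ha, hspan, hli⟩ := exists_linearIndependent' (K := K) B.col
  haveI : Fintype κ₁ := Fintype.ofInjective a ha
  have hr : B.rank = Fintype.card κ₁ := by
    rw [Matrix.rank_eq_finrank_span_cols, ← hspan]
    exact finrank_span_eq_card hli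
  -- the column-restricted matrix has rank `r`, hence `r` independent rows
  set C : Matrix ι κ₁ K := B.submatrix id a with hC
  have hCcol : C.col = B.col ∘ a := rfl
  have hCrank : C.rank = Fintype.card κ₁ := by
    rw [Matrix.rank_eq_finrank_span_cols, hCcol]
    exact finrank_span_eq_card hli
  obtain ⟨ι₁, b, hb, hspan', hli'⟩ := exists_linearIndependent' (K := K) C.row
  haveI : Fintype ι₁ := Fintype.ofInjective b hb
  have hcard : Fintype.card ι₁ = Fintype.card κ₁ := by
    rw [← hCrank, Matrix.rank_eq_finrank_span_row, ← hspan']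
    exact (finrank_span_eq_card hli').symm
  obtain ⟨g⟩ : Nonempty (ι₁ ≃ κ₁) := Fintype.card_eq.mp hcard
  set gk : κ₁ ≃ Fin B.rank := (Fintype.equivFin κ₁).trans (finCongr hr.symm) with hgk
  -- the square matrix on rows `b`, columns `a` is invertible
  have hD : IsUnit (C.submatrix (b ∘ g.symm) id) := by
    rw [← Matrix.linearIndependent_rows_iff_isUnit]
    exact hli'.comp _ g.symm.injective
  have hdet : (C.submatrix (b ∘ g.symm) id).det ≠ 0 :=
    ((Matrix.isUnit_iff_isUnit_det _).mp hD).ne_zero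
  refine ⟨b ∘ g.symm ∘ gk.symm, a ∘ gk.symm, ?_⟩
  have hsq : B.submatrix (b ∘ g.symm ∘ gk.symm) (a ∘ gk.symm) =
      (C.submatrix (b ∘ g.symm) id).submatrix gk.symm gk.symm := by
    ext i j; rfl
  rw [hsq, Matrix.det_submatrix_equiv_self]
  exact hdet

end minors

/-! ## Polynomial kernel sections -/

section sections

variable {σ ι κ : Type*} [Fintype ι] [Fintype κ] [DecidableEq κ]

/-- **Polynomial kernel section through a kernel vector at a point of maximal rank.** -/
theorem exists_kernelSection (A : Matrix ι κ (MvPolynomial σ ℂ))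
    (hrank : ∀ y : σ → ℂ, (A.map (eval y)).rank ≤ (A.map (eval 0)).rank)
    (γ : κ → ℂ) (hγ : (A.map (eval 0)).mulVec γ = 0) :
    ∃ (η : κ → MvPolynomial σ ℂ) (c : ℂ), c ≠ 0 ∧ A.mulVec η = 0 ∧
      ∀ q, eval 0 (η q) = c * γ q := by
  classical
  obtain ⟨e, f, hef⟩ := exists_submatrix_det_ne_zero (A.map (eval 0))
  -- the distinguished minor
  set D : Matrix (Fin (A.map (eval 0)).rank) (Fin (A.map (eval 0)).rank) (MvPolynomial σ ℂ) :=
    A.submatrix e f with hD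
  set Δ : MvPolynomial σ ℂ := D.det with hΔ
  have hΔ0 : eval 0 Δ = ((A.map (eval 0)).submatrix e f).det := by
    rw [hΔ, hD, RingHom.map_det, RingHom.mapMatrix_apply, ← Matrix.submatrix_map]
  -- all `(r+1)`-minors vanish identically
  have hminor : ∀ (e' : Fin (A.map (eval 0)).rank ⊕ Unit → ι)
      (f' : Fin (A.map (eval 0)).rank ⊕ Unit → κ), (A.submatrix e' f').det = 0 := by
    intro e' f'
    apply MvPolynomial.funext
    intro y
    rw [map_zero, RingHom.map_det, RingHom.mapMatrix_apply, ← Matrix.submatrix_map]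
    apply det_submatrix_eq_zero_of_rank_lt
    calc (A.map (eval y)).rank ≤ (A.map (eval 0)).rank := hrank y
      _ < Fintype.card (Fin (A.map (eval 0)).rank ⊕ Unit) := by simp
  -- the section
  set u : Fin (A.map (eval 0)).rank → MvPolynomial σ ℂ := fun i => ∑ q, A (e i) q * C (γ q) with hu
  set w : Fin (A.map (eval 0)).rank → MvPolynomial σ ℂ := D.adjugate.mulVec u with hw
  set η : κ → MvPolynomial σ ℂ := fun q => Δ * C (γ q) - ∑ j, if f j = q then w j else 0 with hη
  -- the rows `e i` annihilate `η`
  have hsumite : ∀ i, ∑ q, A (e i) q * (∑ j, if f j = q then w j else 0) = ∑ j, D i j * w j := by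
    intro i
    simp_rw [Finset.mul_sum, mul_ite, mul_zero]
    rw [Finset.sum_comm]
    refine Finset.sum_congr rfl fun j _ => ?_
    rw [Finset.sum_ite_eq]
    simp [hD]
  have hrow : ∀ i, ∑ q, A (e i) q * η q = 0 := by
    intro i
    have h1 : ∑ q, A (e i) q * (Δ * C (γ q)) = Δ * u i := by
      simp_rw [hu, Finset.mul_sum]
      exact Finset.sum_congr rfl fun q _ => by ring
    have h2 : ∑ j, D i j * w j = Δ * u i := by
      change (D.mulVec w) i = _
      rw [hw, Matrix.mulVec_mulVec, Matrix.mul_adjugate, Matrix.smul_mulVec, Matrix.one_mulVec,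
        Pi.smul_apply, smul_eq_mul]
    simp_rw [hη, mul_sub, Finset.sum_sub_distrib, hsumite, h1, h2, sub_self]
  -- `η(0) = Δ(0)·γ`
  have hη0 : ∀ q, eval 0 (η q) = eval 0 Δ * γ q := by
    intro q
    have hu0 : ∀ j, eval 0 (u j) = 0 := by
      intro j
      simp only [hu, map_sum, map_mul, eval_C]
      have := congrFun hγ (e j)
      simpa [Matrix.mulVec, dotProduct] using this
    have hw0 : ∀ j, eval 0 (w j) = 0 := by
      intro j
      simp only [hw, Matrix.mulVec, dotProduct, map_sum, map_mul, hu0, mul_zero,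
        Finset.sum_const_zero]
    simp only [hη, map_sub, map_mul, eval_C, map_sum]
    rw [Finset.sum_eq_zero fun j _ => ?_, sub_zero]
    split_ifs
    · exact hw0 j
    · exact map_zero _
  refine ⟨η, eval 0 Δ, by rw [hΔ0]; exact hef, ?_, hη0⟩
  -- over the fraction field every row is a combination of the rows `e i`
  have hΔne : Δ ≠ 0 := fun h => hef (by rw [← hΔ0, h, map_zero])
  set F := FractionRing (MvPolynomial σ ℂ) with hF
  set φ : MvPolynomial σ ℂ →+* F := algebraMap (MvPolynomial σ ℂ) F with hφ
  have hφinj : Function.Injective φ := IsFractionRing.injective (MvPolynomial σ ℂ) F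
  set DF : Matrix (Fin (A.map (eval 0)).rank) (Fin (A.map (eval 0)).rank) F := D.map φ with hDF
  have hDFdet : IsUnit DF.det := by
    rw [hDF, ← RingHom.mapMatrix_apply, ← RingHom.map_det]
    exact isUnit_iff_ne_zero.mpr ((map_ne_zero_iff φ hφinj).mpr hΔne)
  letI : Invertible DF := DF.invertibleOfIsUnitDet hDFdet
  have hcomb : ∀ o : ι, ∃ x : Fin (A.map (eval 0)).rank → F,
      ∀ q, φ (A o q) = ∑ i, x i * φ (A (e i) q) := by
    intro o
    refine ⟨Matrix.vecMul (fun j => φ (A o (f j))) ⅟DF, fun q => ?_⟩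
    have hN : (Matrix.fromBlocks DF (Matrix.of fun i (_ : Unit) => φ (A (e i) q))
        (Matrix.of fun (_ : Unit) j => φ (A o (f j)))
        (Matrix.of fun (_ _ : Unit) => φ (A o q))).det = 0 := by
      rw [show Matrix.fromBlocks DF (Matrix.of fun i (_ : Unit) => φ (A (e i) q))
            (Matrix.of fun (_ : Unit) j => φ (A o (f j))) (Matrix.of fun (_ _ : Unit) => φ (A o q)) =
            (A.submatrix (Sum.elim e fun _ => o) (Sum.elim f fun _ => q)).map φ from by
          ext (i | i) (j | j) <;> rfl,
        ← RingHom.mapMatrix_apply, ← RingHom.map_det, hminor, map_zero]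
    rw [Matrix.det_fromBlocks₁₁, mul_eq_zero] at hN
    rcases hN with h | h
    · exact absurd h hDFdet.ne_zero
    · rw [Matrix.det_unique, Matrix.sub_apply, sub_eq_zero, Matrix.of_apply] at h
      rw [h, Matrix.mul_apply]
      refine Finset.sum_congr rfl fun x _ => ?_
      rw [Matrix.mul_apply, Matrix.of_apply]
      rfl
  -- conclude `A η = 0` in `P` from `F`
  have hmv : ∀ o, A.mulVec η o = ∑ q, A o q * η q := fun o => rfl
  funext o
  apply hφinj
  obtain ⟨x, hx⟩ := hcomb o
  rw [Pi.zero_apply, map_zero, hmv, map_sum]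
  calc ∑ q, φ (A o q * η q) = ∑ q, ∑ i, x i * (φ (A (e i) q) * φ (η q)) := by
        refine Finset.sum_congr rfl fun q _ => ?_
        rw [map_mul, hx, Finset.sum_mul]
        exact Finset.sum_congr rfl fun i _ => mul_assoc _ _ _
    _ = ∑ i, x i * φ (∑ q, A (e i) q * η q) := by
        rw [Finset.sum_comm]
        refine Finset.sum_congr rfl fun i _ => ?_
        rw [map_sum, Finset.mul_sum]
        exact Finset.sum_congr rfl fun q _ => by rw [map_mul]
    _ = 0 := Finset.sum_eq_zero fun i _ => by rw [hrow i, map_zero, mul_zero]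

end sections

/-! ## B2 and rung `K = 2` -/

/-- **`KernelSectionAtMaxRank` holds.** -/
theorem kernelSectionAtMaxRank : KernelSectionAtMaxRank := by
  intro n T R hrank γ hγ
  obtain ⟨η, c, hc, hker, h0⟩ := exists_kernelSection (Matrix.of R) hrank γ hγ
  exact ⟨η, c, hc, fun o => congrFun hker o, h0⟩

/-- **B2 — `KernelJetLift` holds**: kernel vectors at a point of maximal rank of a polynomial matrix
extend to kernel 2-jets. -/
theorem kernelJetLift : KernelJetLift :=
  kernelJetLift_of_kernelSection kernelSectionAtMaxRank

/-- **RUNG `K = 2` OF BOUNDED-ORDER PURIFICATION FROM `IsolationAtMaxRank` ALONE.** -/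
theorem boundedOrderPurification_two_of_isolationAtMaxRank (hI : IsolationAtMaxRank) :
    ∀ β : ℝ, 2 ≤ β → EqAdmissibleIdealIso β 2 → ∀ β' : ℝ, β < β' → EqAdmissiblePure β' :=
  boundedOrderPurification_two_of_bridges kernelJetLift hI

/-- The same for reduced systems (`MultiplicityReduction` currency). -/
theorem eqAdmissibleRed_of_isolationAtMaxRank (hI : IsolationAtMaxRank) {β : ℝ}
    (h : EqAdmissibleIdealIso β 2) {β' : ℝ} (hββ' : β < β') : EqAdmissibleRed β' :=
  eqAdmissibleRed_of_bridges kernelJetLift hI h hββ'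

end Summit.MatrixMultiplication.MatrixMultiplication.Theorems.GraphEquations

end
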